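import Literature.NumberTheory.Automorphic.UnitaryThreeUnipotentFixedIsotropicUnique  -- ★ (this seat) `exists_smul_of_isotropic_fixed`, conjugation bookkeeping, `u(a,b)` packaging
import Literature.NumberTheory.Automorphic.UnitaryThreeRegularUnipotentClass         -- ★ p08 (g17): `exists_units_coe_eq_upperTriangularUnipotent`
import Literature.LinearAlgebra.Matrix.FiniteFieldHermitianCongruence               -- ★ `exists_formCongr_one_eq` (every non-degenerate hermitian form over `𝔽_{q²}` is congruent to `1`)
import Literature.GroupTheory.SpecificGroups.FiniteUnitaryGroupCard                 -- ★ set-up `Fintype.card k = q ^ 2`, `σ x = x ^ q`; brings ★ `HermitianSphereCount` (`natCard_sphere_succ_zero`, `natCard_units`)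
import Literature.FieldTheory.FiniteFields.QuadraticTraceKernelCount                -- ★ (this seat) `natCard_traceKer`, `natCard_borelUnipotentParams`
import HarnessLib

/-!
# The unipotent census of `U₃(𝔽_q)`: `(q³+1)(q−1)` transvections, `q(q²−1)(q³+1)` regular unipotents, `(q³+1)(q³−1)` unipotents `≠ 1`
# (Wilson, *The Finite Simple Groups*, §3.6 (3.25), §3.6.1–3.6.2)

Topic `Literature/GroupTheory/SpecificGroups`; namespace `Literature.GroupTheory.SpecificGroups`. THEOREMS ONLY (no definition, no named fact, no instance, no notation,
no `sorry`).  Road «S3-tree» of cell `pub/hodgecm-mathlib` (crux H413 = `stmt-HodgeConjecture-24833`), brick T3′ «depth-zero κ-transfer = the `U₃(𝔽_q) → U₂(𝔽_q)×U₁(𝔽_q)`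
matrix (L4)» (holder F0P3b-p01 (g11)); T3′-ORGAN FILE 2 (chair WORD T10-8 (b), architect A-57 (b) ∕ A-61 (4) «torus-free»; F0P3-p03 (g13)): the SIZES of the three JORDAN STRATA
`rank(u − 1) ∈ {0, 1, 2}` of the unipotent variety of the finite unitary group in three variables, as polynomial count identities in `q`, in the tree's currency
★ `unitaryGroupOfForm σ J₀`, `J₀ = (StdForm.antidiagonal 3).over k` (★ p08's organs classify the strata as CLASSES over any field; ★ `FiniteUnitaryThreeUnipotentJordanClasses`
shows rank = class over `𝔽_{q²}`; here we COUNT).  HONEST LABEL: HC_CM is proved only modulo the printed citations (the 2 remaining named inputs hLiu418, h413) until rung 0 closes;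
this file is elementary and asserts nothing printed about the `p`-adic `U(3)`.

THE PRINT. [Wilson2009, §3.6 (3.25) p. 66]: «`z_n = (q^n − (−1)^n)(q^{n−1} + (−1)^n)`» (so `z₃ = (q³+1)(q²−1)` non-zero isotropic vectors); [Wilson2009, §3.6.1 p. 67]: «the unitary
transvections … for fixed `v` form an abelian normal subgroup of the stabiliser of `⟨v⟩`»; [Wilson2009, §3.6.2 p. 68]: «`Q` denoted by `q^{k(2n−3k)}` … `Z(Q) = Q′ = Φ(Q)` of order
`q^{k²}`» (`n = 3`, `k = 1`: `|Q| = q³`, `|Z(Q)| = q`).  A unipotent `u ≠ 1` of `U₃` fixes EXACTLY ONE isotropic line (★ `exists_smul_of_isotropic_fixed`) and the unipotents fixing `⟨e₀⟩`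
are the `q³` elements `u(a,b)` of `Q` (the transvections among them = `Z(Q) = {n(t)}`), so DOUBLE COUNTING the pairs (non-zero isotropic `v`, unipotent `u ≠ 1` fixing `v`) gives
`#{u ≠ 1}·(q²−1) = (q³+1)(q²−1)·(q³−1)` and `#{transvections}·(q²−1) = (q³+1)(q²−1)·(q−1)`: `q⁶ − 1` unipotents `≠ 1` (Steinberg's `q^{2N}`), `(q³+1)(q−1)` transvections,
`q(q²−1)(q³+1)` regular unipotents (the class sizes `|U₃(q)|∕q³(q+1)²`, `|U₃(q)|∕q²(q+1)` of the character table of `U₃(q)` — consistency remark only, not cited as input).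

* §1 **`natCard_isotropic_antidiag`** — `#{v ∈ k³ : B₀ v v = 0} = q⁵ − q³ + q²` (★ `natCard_sphere_succ_zero` transported along ★ `exists_formCongr_one_eq` ∕ ★ `formCongr_inv_formCongr`);
  **`natCard_isotropic_ne_zero_antidiag`** — `#{v ≠ 0 : B₀ v v = 0} = (q²−1)(q³+1)`.
* §2 **`natCard_unipotent_ne_one_fix_single`** (`= q³ − 1`) and **`natCard_transvection_fix_single`** (`= q − 1`): the unipotents `≠ 1` of `U(σ, J₀)` fixing `e₀`, via the bijection
  with the Borel parameters `{(a,b) ≠ 0 : b + σb + aσa = 0}` (★ `natCard_borelUnipotentParams`, ★ `natCard_traceKer`).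
* §3 **`natCard_mul_units_eq_isotropic_mul_fix`** — the double count for any conjugation-stable family `P` of unipotents `≠ 1`:
  `#{u : P u}·(q²−1) = #{v ≠ 0 isotropic}·#{u : P u, u e₀ = e₀}`; whence **`natCard_unipotent_ne_one`** `= (q³+1)(q³−1)`, **`natCard_transvection`** `= (q³+1)(q−1)`,
  **`natCard_regularUnipotent`** `= q(q²−1)(q³+1)`.

## References
* [Wilson2009] R. A. Wilson, *The Finite Simple Groups*, GTM 251 (2009): §3.6 (3.25) p. 66; §3.6.1 p. 67; §3.6.2 p. 68.
* [Rogawski1990] J. D. Rogawski, *Automorphic Representations of Unitary Groups in Three Variables* (1990): §3.9 p. 32, Prop. 3.9.1 (the three unipotent strata of `U(3)`).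
-/

set_option autoImplicit false

noncomputable section

open Finset Matrix Literature.FieldTheory.FiniteFields Literature.NumberTheory.Automorphic
open Literature.NumberTheory.Automorphic.HermitianLattice Literature.NumberTheory.Automorphic.UnitaryGroup Literature.LinearAlgebra.Matrix

namespace Literature.GroupTheory.SpecificGroups

variable {k : Type*} [Field k] [Fintype k] [DecidableEq k] {q : ℕ}

/-! ### §1 Isotropic vectors of the split form `J₀` on `k³` -/

omit [Fintype k] [DecidableEq k] in
/-- `J₀ = antidiag(1,1,1)` is `σ`-hermitian with non-zero determinant. [cite: Wilson2009, §3.6 p. 66] -/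
theorem antidiagonal_three_hermitian_det (σ : k →+* k) :
    (((StdForm.antidiagonal 3).over k).map σ)ᵀ = (StdForm.antidiagonal 3).over k ∧ ((StdForm.antidiagonal 3).over k).det ≠ 0 :=
  ⟨by rw [StdForm.over_map, StdForm.transpose_over], ((Matrix.isUnit_iff_isUnit_det _).1 ((StdForm.antidiagonal 3).isUnit_over k)).ne_zero⟩

omit [Fintype k] [DecidableEq k] in
/-- Along a congruence `σ(T)ᵀ T = J₀` the form `B₀` becomes the standard hermitian norm: `B₀ (T⁻¹x) (T⁻¹x) = Σ σ(x_i) x_i`. [cite: Wilson2009, §3.6 (3.25) p. 66] -/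
theorem B₀_inv_mulVec_self_eq_sum (σ : k →+* k) {T : GL (Fin 3) k} (hT : formCongr σ T (1 : Matrix (Fin 3) (Fin 3) k) = (StdForm.antidiagonal 3).over k)
    (x : Fin 3 → k) :
    B₀ σ 3 (((T⁻¹ : GL (Fin 3) k) : Matrix (Fin 3) (Fin 3) k) *ᵥ x) (((T⁻¹ : GL (Fin 3) k) : Matrix (Fin 3) (Fin 3) k) *ᵥ x) = ∑ i, σ (x i) * x i := by
  have h1 : (((T⁻¹ : GL (Fin 3) k) : Matrix (Fin 3) (Fin 3) k).map σ)ᵀ * (StdForm.antidiagonal 3).over k * ((T⁻¹ : GL (Fin 3) k) : Matrix (Fin 3) (Fin 3) k) = 1 := by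
    have := formCongr_inv_formCongr σ T (1 : Matrix (Fin 3) (Fin 3) k)
    rw [hT] at this
    exact this
  rw [B₀_mulVec_mulVec, h1]
  refine sum_congr rfl fun a _ => ?_
  simp only [Matrix.one_apply, mul_ite, mul_one, mul_zero, sum_ite_eq, mem_univ, if_true]

/-- **`#{v ∈ k³ : B₀ v v = 0} = q⁵ − q³ + q²`** (Wilson's `1 + z₃ = 1 + (q³+1)(q²−1)`), transported from the standard form by a congruence `σ(T)ᵀ T = J₀` (★ `exists_formCongr_one_eq`).
[cite: Wilson2009, §3.6 (3.25) p. 66] -/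
theorem natCard_isotropic_antidiag (hk : Fintype.card k = q ^ 2) (σ : k →+* k) (hσ : ∀ x, σ x = x ^ q) :
    (Nat.card {v : Fin 3 → k // B₀ σ 3 v v = 0} : ℤ) = (q : ℤ) ^ 5 - (q : ℤ) ^ 3 + (q : ℤ) ^ 2 := by
  obtain ⟨hherm, hdet⟩ := antidiagonal_three_hermitian_det σ
  obtain ⟨T, hT⟩ := exists_formCongr_one_eq hk σ hσ ((StdForm.antidiagonal 3).over k) hherm hdet
  have hTT : ((T⁻¹ : GL (Fin 3) k) : Matrix (Fin 3) (Fin 3) k) * (T : Matrix (Fin 3) (Fin 3) k) = 1 := by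
    rw [← Units.val_mul, inv_mul_cancel, Units.val_one]
  have hTT' : (T : Matrix (Fin 3) (Fin 3) k) * ((T⁻¹ : GL (Fin 3) k) : Matrix (Fin 3) (Fin 3) k) = 1 := by
    rw [← Units.val_mul, mul_inv_cancel, Units.val_one]
  have key := B₀_inv_mulVec_self_eq_sum σ hT
  -- `v ↦ T v` is a bijection `{B₀ v v = 0} ≃ {Σ σ(x_i) x_i = 0}`
  have e : {v : Fin 3 → k // B₀ σ 3 v v = 0} ≃ {x : Fin 3 → k // ∑ i, σ (x i) * x i = 0} :=
    { toFun := fun v => ⟨(T : Matrix (Fin 3) (Fin 3) k) *ᵥ v.1, by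
        rw [← key, Matrix.mulVec_mulVec, hTT, Matrix.one_mulVec]; exact v.2⟩
      invFun := fun x => ⟨((T⁻¹ : GL (Fin 3) k) : Matrix (Fin 3) (Fin 3) k) *ᵥ x.1, by rw [key]; exact x.2⟩
      left_inv := fun v => Subtype.ext (by simp only [Matrix.mulVec_mulVec, hTT, Matrix.one_mulVec])
      right_inv := fun x => Subtype.ext (by simp only [Matrix.mulVec_mulVec, hTT', Matrix.one_mulVec]) }
  rw [Nat.card_congr e, natCard_sphere_succ_zero hk σ hσ 2]
  ring

/-- **`#{v ≠ 0 : B₀ v v = 0} = (q² − 1)(q³ + 1)`** — the non-zero isotropic vectors of `(k³, J₀)` (Wilson's `z₃`; `q³ + 1` isotropic points of `q² − 1` non-zero vectors each).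
[cite: Wilson2009, §3.6 (3.25) p. 66] -/
theorem natCard_isotropic_ne_zero_antidiag (hk : Fintype.card k = q ^ 2) (σ : k →+* k) (hσ : ∀ x, σ x = x ^ q) :
    (Nat.card {v : Fin 3 → k // v ≠ 0 ∧ B₀ σ 3 v v = 0} : ℤ) = ((q : ℤ) ^ 2 - 1) * ((q : ℤ) ^ 3 + 1) := by
  have hall := natCard_isotropic_antidiag hk σ hσ
  -- split off the zero vector
  have hsplit : Nat.card {v : Fin 3 → k // B₀ σ 3 v v = 0} = Nat.card {v : Fin 3 → k // v ≠ 0 ∧ B₀ σ 3 v v = 0} + 1 := by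
    rw [Nat.card_eq_fintype_card, Nat.card_eq_fintype_card, Fintype.card_subtype, Fintype.card_subtype]
    rw [← card_filter_add_card_filter_not (s := univ.filter fun v : Fin 3 → k => B₀ σ 3 v v = 0) (fun v => v ≠ 0)]
    congr 1
    · congr 1; ext v; simp only [mem_filter, mem_univ, true_and]; tauto
    · rw [card_eq_one]
      refine ⟨0, ?_⟩
      ext v
      simp only [mem_filter, mem_univ, true_and, not_not, mem_singleton]
      constructor
      · exact fun h => h.2
      · rintro rfl; exact ⟨by simp, rfl⟩
  have h' : (Nat.card {v : Fin 3 → k // B₀ σ 3 v v = 0} : ℤ) = Nat.card {v : Fin 3 → k // v ≠ 0 ∧ B₀ σ 3 v v = 0} + 1 := by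
    exact_mod_cast hsplit
  linear_combination hall - h'

/-! ### §2 The unipotents `≠ 1` fixing `e₀`: `q³ − 1`, of which `q − 1` transvections -/

section FixSingle

variable {K : Type*} [Field K] (σ : K →+* K)

/-- **Normal form of a unipotent of `U(σ, J₀)` fixing `e₀`, read off its own entries**: `u = u(u₀₁, u₀₂)` with `u₀₂ + σu₀₂ + u₀₁·σu₀₁ = 0` (★ p08's upper-triangular form + ★ membership).
[cite: Rogawski1990, §3.9 p. 32] [cite: Wilson2009, §3.6.2 p. 68] -/
theorem coe_eq_upperUnipotent_entries (hσ : ∀ z : K, σ (σ z) = z) {u : GL (Fin 3) K} (hu : u ∈ unitaryGroupOfForm σ ((StdForm.antidiagonal 3).over K))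
    (hnil : IsNilpotent ((u : Matrix (Fin 3) (Fin 3) K) - 1)) (he : (u : Matrix (Fin 3) (Fin 3) K) *ᵥ Pi.single 0 1 = Pi.single 0 1) :
    (u : Matrix (Fin 3) (Fin 3) K) = !![1, (u : Matrix (Fin 3) (Fin 3) K) 0 1, (u : Matrix (Fin 3) (Fin 3) K) 0 2; 0, 1, -σ ((u : Matrix (Fin 3) (Fin 3) K) 0 1); 0, 0, 1] ∧
      (u : Matrix (Fin 3) (Fin 3) K) 0 2 + σ ((u : Matrix (Fin 3) (Fin 3) K) 0 2) + (u : Matrix (Fin 3) (Fin 3) K) 0 1 * σ ((u : Matrix (Fin 3) (Fin 3) K) 0 1) = 0 := by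
  obtain ⟨a, b, r, hmat⟩ := exists_coe_eq_upperTriangular_of_mulVec_single σ hu (c := 1) (by rw [one_smul]; exact he) hnil
  obtain ⟨hr, hab⟩ := (mem_unitaryGroupOfForm_iff_of_coe_eq_upperUnipotent σ hσ hmat).1 hu
  have h01 : (u : Matrix (Fin 3) (Fin 3) K) 0 1 = a := by rw [hmat]; rfl
  have h02 : (u : Matrix (Fin 3) (Fin 3) K) 0 2 = b := by rw [hmat]; rfl
  rw [h01, h02]
  exact ⟨by rw [hmat, hr], hab⟩

/-- A unipotent of `U(σ, J₀)` fixing `e₀` is determined by its entries `(u₀₁, u₀₂)`. [cite: Rogawski1990, §3.9 p. 32] -/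
theorem eq_of_entries_eq (hσ : ∀ z : K, σ (σ z) = z) {u u' : GL (Fin 3) K}
    (hu : u ∈ unitaryGroupOfForm σ ((StdForm.antidiagonal 3).over K)) (hnil : IsNilpotent ((u : Matrix (Fin 3) (Fin 3) K) - 1))
    (he : (u : Matrix (Fin 3) (Fin 3) K) *ᵥ Pi.single 0 1 = Pi.single 0 1)
    (hu' : u' ∈ unitaryGroupOfForm σ ((StdForm.antidiagonal 3).over K)) (hnil' : IsNilpotent ((u' : Matrix (Fin 3) (Fin 3) K) - 1))
    (he' : (u' : Matrix (Fin 3) (Fin 3) K) *ᵥ Pi.single 0 1 = Pi.single 0 1)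
    (h01 : (u : Matrix (Fin 3) (Fin 3) K) 0 1 = (u' : Matrix (Fin 3) (Fin 3) K) 0 1) (h02 : (u : Matrix (Fin 3) (Fin 3) K) 0 2 = (u' : Matrix (Fin 3) (Fin 3) K) 0 2) :
    u = u' := by
  have h := (coe_eq_upperUnipotent_entries σ hσ hu hnil he).1
  have h' := (coe_eq_upperUnipotent_entries σ hσ hu' hnil' he').1
  exact Units.ext (by rw [h, h', h01, h02])

end FixSingle

/-- **The unipotents `≠ 1` of `U(σ, J₀)` fixing `e₀` are `q³ − 1` in number** — they are the `u(a,b)`, `(a,b) ≠ (0,0)`, `b + σb + aσa = 0` (★ normal form + ★ `natCard_borelUnipotentParams`):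
`|Q| − 1` for the unipotent radical `Q` of the Borel. [cite: Wilson2009, §3.6.2 p. 68] [cite: Rogawski1990, §3.9 p. 32] -/
theorem natCard_unipotent_ne_one_fix_single (hk : Fintype.card k = q ^ 2) (σ : k →+* k) (hσ : ∀ x, σ x = x ^ q) :
    Nat.card {u : GL (Fin 3) k // (u ∈ unitaryGroupOfForm σ ((StdForm.antidiagonal 3).over k) ∧ IsNilpotent ((u : Matrix (Fin 3) (Fin 3) k) - 1) ∧ u ≠ 1) ∧
        (u : Matrix (Fin 3) (Fin 3) k) *ᵥ Pi.single 0 1 = Pi.single 0 1} = q ^ 3 - 1 := by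
  classical
  have hσσ := frob_frob hk σ hσ
  -- count of the parameter set minus the origin
  have hpar : Nat.card {p : k × k // p.2 + σ p.2 + p.1 * σ p.1 = 0 ∧ p ≠ (0, 0)} = q ^ 3 - 1 := by
    have htot := natCard_borelUnipotentParams hk σ hσ
    have hsplit := Nat.card_congr (Equiv.sumCompl fun x : {p : k × k // p.2 + σ p.2 + p.1 * σ p.1 = 0} => x.1 ≠ (0, 0)).symm
    rw [Nat.card_sum, htot] at hsplit
    have hone : Nat.card {x : {p : k × k // p.2 + σ p.2 + p.1 * σ p.1 = 0} // ¬ x.1 ≠ (0, 0)} = 1 := by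
      rw [Nat.card_eq_one_iff_unique]
      exact ⟨⟨fun x y => Subtype.ext (Subtype.ext ((not_not.1 x.2).trans (not_not.1 y.2).symm))⟩, ⟨⟨⟨(0, 0), by simp⟩, by simp⟩⟩⟩
    have hne : Nat.card {x : {p : k × k // p.2 + σ p.2 + p.1 * σ p.1 = 0} // x.1 ≠ (0, 0)} =
        Nat.card {p : k × k // p.2 + σ p.2 + p.1 * σ p.1 = 0 ∧ p ≠ (0, 0)} :=
      Nat.card_congr (Equiv.subtypeSubtypeEquivSubtypeInter (fun p : k × k => p.2 + σ p.2 + p.1 * σ p.1 = 0) fun p => p ≠ (0, 0))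
    omega
  rw [← hpar]
  -- the entries map is a bijection
  refine Nat.card_eq_of_bijective
    (fun u => ⟨(((u.1 : GL (Fin 3) k) : Matrix (Fin 3) (Fin 3) k) 0 1, ((u.1 : GL (Fin 3) k) : Matrix (Fin 3) (Fin 3) k) 0 2), ?_⟩) ⟨?_, ?_⟩
  · obtain ⟨⟨hu, hnil, hne⟩, he⟩ := u.2
    obtain ⟨hform, hcond⟩ := coe_eq_upperUnipotent_entries σ hσσ hu hnil he
    refine ⟨hcond, fun h0 => hne ((upperUnipotent_eq_one_iff σ hform).2 ⟨?_, ?_⟩)⟩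
    · exact congrArg Prod.fst h0
    · exact congrArg Prod.snd h0
  · rintro ⟨u, ⟨hu, hnil, hne⟩, he⟩ ⟨u', ⟨hu', hnil', hne'⟩, he'⟩ h
    have h' := congrArg Subtype.val h
    simp only [Prod.mk.injEq] at h'
    exact Subtype.ext (eq_of_entries_eq σ hσσ hu hnil he hu' hnil' he' h'.1 h'.2)
  · rintro ⟨⟨a, b⟩, hab, hne⟩
    obtain ⟨n, hn, -⟩ := exists_units_coe_eq_upperTriangularUnipotent a b (-σ a)
    obtain ⟨hmem, hnil, he⟩ := upperUnipotent_mem_and_isNilpotent σ hσσ hab hn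
    refine ⟨⟨n, ⟨hmem, hnil, fun h1 => hne ?_⟩, he⟩, Subtype.ext ?_⟩
    · obtain ⟨ha, hb⟩ := (upperUnipotent_eq_one_iff σ hn).1 h1
      rw [ha, hb]
    · simp only [hn]; rfl

/-- **The transvections of `U(σ, J₀)` fixing `e₀` are `q − 1` in number** — the non-trivial `n(t)`, `σt + t = 0` (★ `natCard_traceKer`): `|Z(Q)| − 1`.
[cite: Wilson2009, §3.6.1 p. 67, §3.6.2 p. 68] [cite: Rogawski1990, §3.9 p. 32] -/
theorem natCard_transvection_fix_single (hk : Fintype.card k = q ^ 2) (σ : k →+* k) (hσ : ∀ x, σ x = x ^ q) :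
    Nat.card {u : GL (Fin 3) k // (u ∈ unitaryGroupOfForm σ ((StdForm.antidiagonal 3).over k) ∧
        ((u : Matrix (Fin 3) (Fin 3) k) - 1) * ((u : Matrix (Fin 3) (Fin 3) k) - 1) = 0 ∧ u ≠ 1) ∧
        (u : Matrix (Fin 3) (Fin 3) k) *ᵥ Pi.single 0 1 = Pi.single 0 1} = q - 1 := by
  classical
  have hσσ := frob_frob hk σ hσ
  have hpar : Nat.card {t : k // σ t + t = 0 ∧ t ≠ 0} = q - 1 := by
    have htot := natCard_traceKer hk σ hσ
    have hsplit := Nat.card_congr (Equiv.sumCompl fun x : {t : k // σ t + t = 0} => x.1 ≠ 0).symm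
    rw [Nat.card_sum, htot] at hsplit
    have hone : Nat.card {x : {t : k // σ t + t = 0} // ¬ x.1 ≠ 0} = 1 := by
      rw [Nat.card_eq_one_iff_unique]
      exact ⟨⟨fun x y => Subtype.ext (Subtype.ext ((not_not.1 x.2).trans (not_not.1 y.2).symm))⟩, ⟨⟨⟨0, by simp⟩, by simp⟩⟩⟩
    have hne : Nat.card {x : {t : k // σ t + t = 0} // x.1 ≠ 0} = Nat.card {t : k // σ t + t = 0 ∧ t ≠ 0} :=
      Nat.card_congr (Equiv.subtypeSubtypeEquivSubtypeInter (fun t : k => σ t + t = 0) fun t => t ≠ 0)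
    omega
  rw [← hpar]
  have nil_of_sq : ∀ {u : GL (Fin 3) k}, ((u : Matrix (Fin 3) (Fin 3) k) - 1) * ((u : Matrix (Fin 3) (Fin 3) k) - 1) = 0 →
      IsNilpotent ((u : Matrix (Fin 3) (Fin 3) k) - 1) := fun h => ⟨2, by rw [pow_two, h]⟩
  refine Nat.card_eq_of_bijective (fun u => ⟨((u.1 : GL (Fin 3) k) : Matrix (Fin 3) (Fin 3) k) 0 2, ?_⟩) ⟨?_, ?_⟩
  · obtain ⟨⟨hu, hsq, hne⟩, he⟩ := u.2
    obtain ⟨hform, hcond⟩ := coe_eq_upperUnipotent_entries σ hσσ hu (nil_of_sq hsq) he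
    have ha : ((u.1 : GL (Fin 3) k) : Matrix (Fin 3) (Fin 3) k) 0 1 = 0 := (upperUnipotent_sq_eq_zero_iff σ hσσ hcond hform).1 hsq
    rw [ha, zero_mul, add_zero] at hcond
    refine ⟨by rw [add_comm]; exact hcond, fun h0 => hne ((upperUnipotent_eq_one_iff σ hform).2 ⟨ha, h0⟩)⟩
  · rintro ⟨u, ⟨hu, hsq, hne⟩, he⟩ ⟨u', ⟨hu', hsq', hne'⟩, he'⟩ h
    have h' : ((u : Matrix (Fin 3) (Fin 3) k)) 0 2 = (u' : Matrix (Fin 3) (Fin 3) k) 0 2 := congrArg Subtype.val h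
    have ha : (u : Matrix (Fin 3) (Fin 3) k) 0 1 = 0 :=
      (upperUnipotent_sq_eq_zero_iff σ hσσ (coe_eq_upperUnipotent_entries σ hσσ hu (nil_of_sq hsq) he).2
        (coe_eq_upperUnipotent_entries σ hσσ hu (nil_of_sq hsq) he).1).1 hsq
    have ha' : (u' : Matrix (Fin 3) (Fin 3) k) 0 1 = 0 :=
      (upperUnipotent_sq_eq_zero_iff σ hσσ (coe_eq_upperUnipotent_entries σ hσσ hu' (nil_of_sq hsq') he').2
        (coe_eq_upperUnipotent_entries σ hσσ hu' (nil_of_sq hsq') he').1).1 hsq'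
    exact Subtype.ext (eq_of_entries_eq σ hσσ hu (nil_of_sq hsq) he hu' (nil_of_sq hsq') he' (ha.trans ha'.symm) h')
  · rintro ⟨t, ht, hne⟩
    obtain ⟨n, hn, -⟩ := exists_units_coe_eq_upperTriangularUnipotent (0 : k) t (-σ 0)
    have hab : t + σ t + 0 * σ 0 = 0 := by rw [zero_mul, add_zero, add_comm]; exact ht
    obtain ⟨hmem, -, he⟩ := upperUnipotent_mem_and_isNilpotent σ hσσ hab hn
    have hsq := (upperUnipotent_sq_eq_zero_iff σ hσσ hab hn).2 rfl
    refine ⟨⟨n, ⟨hmem, hsq, fun h1 => hne ((upperUnipotent_eq_one_iff σ hn).1 h1).2⟩, he⟩, Subtype.ext ?_⟩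
    simp only [hn]; rfl

/-! ### §3 The double count and the census -/

/-- **The double count.**  For any family `P` of unipotents `≠ 1` of `U(σ, J₀)` stable under `U(σ, J₀)`-conjugation, counting the pairs (`u` with `P u`, non-zero isotropic `v` fixed by
`u`) in two ways — every such `u` fixes exactly the `q² − 1` non-zero vectors of ONE isotropic line (★ `exists_isotropic_fixed_of_isNilpotent`, ★ `exists_smul_of_isotropic_fixed`),
and `U(σ, J₀)` is transitive on non-zero isotropic vectors (★ `exists_mem_unitaryGroupOfForm_mulVec_single_eq`) — gives `#{u : P u}·(q²−1) = #{v ≠ 0 isotropic}·#{u : P u, u e₀ = e₀}`.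
[cite: Wilson2009, §3.6.1 p. 67] -/
theorem natCard_mul_units_eq_isotropic_mul_fix (hk : Fintype.card k = q ^ 2) (σ : k →+* k) (hσ : ∀ x, σ x = x ^ q)
    (P : GL (Fin 3) k → Prop)
    (hPU : ∀ u, P u → u ∈ unitaryGroupOfForm σ ((StdForm.antidiagonal 3).over k) ∧ IsNilpotent ((u : Matrix (Fin 3) (Fin 3) k) - 1) ∧ u ≠ 1)
    (hPconj : ∀ g ∈ unitaryGroupOfForm σ ((StdForm.antidiagonal 3).over k), ∀ u, P u → P (g⁻¹ * u * g)) :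
    Nat.card {u : GL (Fin 3) k // P u} * (q ^ 2 - 1) =
      Nat.card {v : Fin 3 → k // v ≠ 0 ∧ B₀ σ 3 v v = 0} *
        Nat.card {u : GL (Fin 3) k // P u ∧ (u : Matrix (Fin 3) (Fin 3) k) *ᵥ Pi.single 0 1 = Pi.single 0 1} := by
  classical
  have hσσ := frob_frob hk σ hσ
  -- (i) fibres over `u`: the non-zero vectors of the fixed isotropic line, `q² − 1` of them
  have hfib1 : ∀ u : {u : GL (Fin 3) k // P u},
      Nat.card {v : {v : Fin 3 → k // v ≠ 0 ∧ B₀ σ 3 v v = 0} // ((u.1 : GL (Fin 3) k) : Matrix (Fin 3) (Fin 3) k) *ᵥ v.1 = v.1} = q ^ 2 - 1 := by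
    intro u
    obtain ⟨hu, hnil, hne⟩ := hPU u.1 u.2
    obtain ⟨v₀, hv₀, hfix₀, hiso₀⟩ := exists_isotropic_fixed_of_isNilpotent σ hu hnil hne
    rw [← natCard_units hk]
    symm
    refine Nat.card_eq_of_bijective (fun c : kˣ => ⟨⟨(c : k) • v₀, smul_ne_zero c.ne_zero hv₀, ?_⟩, ?_⟩) ⟨?_, ?_⟩
    · rw [LinearMap.map_smulₛₗ₂, map_smul, hiso₀, smul_zero, smul_zero]
    · show ((u.1 : GL (Fin 3) k) : Matrix (Fin 3) (Fin 3) k) *ᵥ ((c : k) • v₀) = (c : k) • v₀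
      rw [Matrix.mulVec_smul, hfix₀]
    · intro c c' h
      have h' : (c : k) • v₀ = (c' : k) • v₀ := congrArg (fun x => x.1.1) h
      exact Units.ext (smul_left_injective k hv₀ h')
    · rintro ⟨⟨w, hw0, hwiso⟩, hwfix⟩
      obtain ⟨c, hc⟩ := exists_smul_of_isotropic_fixed σ hσσ hu hnil hne hv₀ hiso₀ hfix₀ hwiso hwfix
      have hc0 : c ≠ 0 := by rintro rfl; exact hw0 (by rw [hc, zero_smul])
      exact ⟨Units.mk0 c hc0, Subtype.ext (Subtype.ext (by simp [hc]))⟩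
  -- (ii) fibres over `v`: conjugate to the fibre over `e₀`
  have hfib2 : ∀ v : {v : Fin 3 → k // v ≠ 0 ∧ B₀ σ 3 v v = 0},
      Nat.card {u : {u : GL (Fin 3) k // P u} // ((u.1 : GL (Fin 3) k) : Matrix (Fin 3) (Fin 3) k) *ᵥ v.1 = v.1} =
        Nat.card {u : GL (Fin 3) k // P u ∧ (u : Matrix (Fin 3) (Fin 3) k) *ᵥ Pi.single 0 1 = Pi.single 0 1} := by
    intro v
    obtain ⟨g, hg, hge⟩ := exists_mem_unitaryGroupOfForm_mulVec_single_eq σ hσσ v.2.1 v.2.2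
    refine Nat.card_congr
      { toFun := fun u => ⟨g⁻¹ * u.1.1 * g, hPconj g hg _ u.1.2, invConj_mulVec_eq_self (by rw [hge]; exact u.2)⟩
        invFun := fun u => ⟨⟨g * u.1 * g⁻¹, by simpa only [inv_inv] using hPconj g⁻¹ (Subgroup.inv_mem _ hg) _ u.2.1⟩, by
          show ((g * u.1 * g⁻¹ : GL (Fin 3) k) : Matrix (Fin 3) (Fin 3) k) *ᵥ v.1 = v.1
          rw [← hge]
          exact mulVec_mulVec_eq_of_invConj (by rw [show g⁻¹ * (g * u.1 * g⁻¹) * g = u.1 from by group]; exact u.2.2)⟩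
        left_inv := fun u => Subtype.ext (Subtype.ext (by show g * (g⁻¹ * u.1.1 * g) * g⁻¹ = u.1.1; group))
        right_inv := fun u => Subtype.ext (by show g⁻¹ * (g * u.1 * g⁻¹) * g = u.1; group) }
  -- the incidence set, counted both ways
  have h1 : Nat.card {x : {u : GL (Fin 3) k // P u} × {v : Fin 3 → k // v ≠ 0 ∧ B₀ σ 3 v v = 0} //
      ((x.1.1 : GL (Fin 3) k) : Matrix (Fin 3) (Fin 3) k) *ᵥ x.2.1 = x.2.1} = Nat.card {u : GL (Fin 3) k // P u} * (q ^ 2 - 1) := by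
    rw [Nat.card_congr (Equiv.subtypeProdEquivSigmaSubtype fun (u : {u : GL (Fin 3) k // P u}) (v : {v : Fin 3 → k // v ≠ 0 ∧ B₀ σ 3 v v = 0}) =>
      ((u.1 : GL (Fin 3) k) : Matrix (Fin 3) (Fin 3) k) *ᵥ v.1 = v.1), Nat.card_sigma]
    simp only [hfib1, sum_const, card_univ, smul_eq_mul, Nat.card_eq_fintype_card]
  have h2 : Nat.card {x : {u : GL (Fin 3) k // P u} × {v : Fin 3 → k // v ≠ 0 ∧ B₀ σ 3 v v = 0} //
      ((x.1.1 : GL (Fin 3) k) : Matrix (Fin 3) (Fin 3) k) *ᵥ x.2.1 = x.2.1} =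
        Nat.card {v : Fin 3 → k // v ≠ 0 ∧ B₀ σ 3 v v = 0} *
          Nat.card {u : GL (Fin 3) k // P u ∧ (u : Matrix (Fin 3) (Fin 3) k) *ᵥ Pi.single 0 1 = Pi.single 0 1} := by
    have e2 : {x : {u : GL (Fin 3) k // P u} × {v : Fin 3 → k // v ≠ 0 ∧ B₀ σ 3 v v = 0} //
        ((x.1.1 : GL (Fin 3) k) : Matrix (Fin 3) (Fin 3) k) *ᵥ x.2.1 = x.2.1} ≃
        Σ v : {v : Fin 3 → k // v ≠ 0 ∧ B₀ σ 3 v v = 0}, {u : {u : GL (Fin 3) k // P u} // ((u.1 : GL (Fin 3) k) : Matrix (Fin 3) (Fin 3) k) *ᵥ v.1 = v.1} :=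
      { toFun := fun x => ⟨x.1.2, ⟨x.1.1, x.2⟩⟩
        invFun := fun y => ⟨(y.2.1, y.1), y.2.2⟩
        left_inv := fun x => rfl
        right_inv := fun y => rfl }
    rw [Nat.card_congr e2, Nat.card_sigma]
    simp only [hfib2, sum_const, card_univ, smul_eq_mul, Nat.card_eq_fintype_card]
  rw [← h1, h2]

/-- **`#{u ∈ U₃(𝔽_q) unipotent, u ≠ 1} = (q³ + 1)(q³ − 1)`** (`= q⁶ − 1`, Steinberg's count of unipotents `q^{2N} = q⁶`). [cite: Wilson2009, §3.6.2 p. 68] [cite: Rogawski1990, §3.9 p. 32] -/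
theorem natCard_unipotent_ne_one (hk : Fintype.card k = q ^ 2) (σ : k →+* k) (hσ : ∀ x, σ x = x ^ q) :
    Nat.card {u : GL (Fin 3) k // u ∈ unitaryGroupOfForm σ ((StdForm.antidiagonal 3).over k) ∧ IsNilpotent ((u : Matrix (Fin 3) (Fin 3) k) - 1) ∧ u ≠ 1} =
      (q ^ 3 + 1) * (q ^ 3 - 1) := by
  have hσσ := frob_frob hk σ hσ
  have hcount := natCard_mul_units_eq_isotropic_mul_fix hk σ hσ
    (fun u => u ∈ unitaryGroupOfForm σ ((StdForm.antidiagonal 3).over k) ∧ IsNilpotent ((u : Matrix (Fin 3) (Fin 3) k) - 1) ∧ u ≠ 1)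
    (fun u h => h)
    (fun g hg u ⟨hu, hnil, hne⟩ => ⟨Subgroup.mul_mem _ (Subgroup.mul_mem _ (Subgroup.inv_mem _ hg) hu) hg, isNilpotent_invConj_sub_one hnil,
      fun h1 => hne (by rw [show u = g * (g⁻¹ * u * g) * g⁻¹ from by group, h1]; group)⟩)
  rw [natCard_unipotent_ne_one_fix_single hk σ hσ] at hcount
  have hiso := natCard_isotropic_ne_zero_antidiag hk σ hσ; have h2 := two_le_q hk
  have hq3 : 1 ≤ q ^ 3 := Nat.one_le_pow _ _ (by omega); have hq2 : 1 ≤ q ^ 2 := Nat.one_le_pow _ _ (by omega)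
  have hcz : (Nat.card {u : GL (Fin 3) k // u ∈ unitaryGroupOfForm σ ((StdForm.antidiagonal 3).over k) ∧
      IsNilpotent ((u : Matrix (Fin 3) (Fin 3) k) - 1) ∧ u ≠ 1} : ℤ) * ((q : ℤ) ^ 2 - 1) = ((q : ℤ) ^ 2 - 1) * ((q : ℤ) ^ 3 + 1) * ((q : ℤ) ^ 3 - 1) := by
    have := congrArg (Nat.cast : ℕ → ℤ) hcount
    push_cast [Nat.cast_sub hq3, Nat.cast_sub hq2] at this
    rw [hiso] at this
    linear_combination this
  have hq2z : (2 : ℤ) ≤ q := by exact_mod_cast h2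
  have hne : ((q : ℤ) ^ 2 - 1) ≠ 0 := by nlinarith
  have hz : (Nat.card {u : GL (Fin 3) k // u ∈ unitaryGroupOfForm σ ((StdForm.antidiagonal 3).over k) ∧
      IsNilpotent ((u : Matrix (Fin 3) (Fin 3) k) - 1) ∧ u ≠ 1} : ℤ) = ((q : ℤ) ^ 3 + 1) * ((q : ℤ) ^ 3 - 1) :=
    mul_right_cancel₀ hne (by linear_combination hcz)
  have : (((q ^ 3 + 1) * (q ^ 3 - 1) : ℕ) : ℤ) = ((q : ℤ) ^ 3 + 1) * ((q : ℤ) ^ 3 - 1) := by push_cast [Nat.cast_sub hq3]; ring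
  exact_mod_cast hz.trans this.symm

/-- **`#{transvections of U₃(𝔽_q)} = (q³ + 1)(q − 1)`** — the unipotents with `(u − 1)² = 0`, `u ≠ 1`: `q³ + 1` centres times `|Z(Q)| − 1 = q − 1` (ONE conjugacy class, of size
`|U₃(q)|∕q³(q+1)²`). [cite: Wilson2009, §3.6.1 p. 67, §3.6.2 p. 68] [cite: Rogawski1990, §3.9 p. 32] -/
theorem natCard_transvection (hk : Fintype.card k = q ^ 2) (σ : k →+* k) (hσ : ∀ x, σ x = x ^ q) :
    Nat.card {u : GL (Fin 3) k // u ∈ unitaryGroupOfForm σ ((StdForm.antidiagonal 3).over k) ∧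
      ((u : Matrix (Fin 3) (Fin 3) k) - 1) * ((u : Matrix (Fin 3) (Fin 3) k) - 1) = 0 ∧ u ≠ 1} = (q ^ 3 + 1) * (q - 1) := by
  have hσσ := frob_frob hk σ hσ
  have hcount := natCard_mul_units_eq_isotropic_mul_fix hk σ hσ
    (fun u => u ∈ unitaryGroupOfForm σ ((StdForm.antidiagonal 3).over k) ∧
      ((u : Matrix (Fin 3) (Fin 3) k) - 1) * ((u : Matrix (Fin 3) (Fin 3) k) - 1) = 0 ∧ u ≠ 1)
    (fun u ⟨hu, hsq, hne⟩ => ⟨hu, ⟨2, by rw [pow_two, hsq]⟩, hne⟩)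
    (fun g hg u ⟨hu, hsq, hne⟩ => ⟨Subgroup.mul_mem _ (Subgroup.mul_mem _ (Subgroup.inv_mem _ hg) hu) hg, invConj_sub_one_sq_eq_zero hsq,
      fun h1 => hne (by rw [show u = g * (g⁻¹ * u * g) * g⁻¹ from by group, h1]; group)⟩)
  rw [natCard_transvection_fix_single hk σ hσ] at hcount
  have hiso := natCard_isotropic_ne_zero_antidiag hk σ hσ; have h2 := two_le_q hk
  have hq2 : 1 ≤ q ^ 2 := Nat.one_le_pow _ _ (by omega); have hq1 : 1 ≤ q := by omega
  have hcz : (Nat.card {u : GL (Fin 3) k // u ∈ unitaryGroupOfForm σ ((StdForm.antidiagonal 3).over k) ∧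
      ((u : Matrix (Fin 3) (Fin 3) k) - 1) * ((u : Matrix (Fin 3) (Fin 3) k) - 1) = 0 ∧ u ≠ 1} : ℤ) * ((q : ℤ) ^ 2 - 1) =
        ((q : ℤ) ^ 2 - 1) * ((q : ℤ) ^ 3 + 1) * ((q : ℤ) - 1) := by
    have := congrArg (Nat.cast : ℕ → ℤ) hcount
    push_cast [Nat.cast_sub hq1, Nat.cast_sub hq2] at this
    rw [hiso] at this
    linear_combination this
  have hq2z : (2 : ℤ) ≤ q := by exact_mod_cast h2
  have hne : ((q : ℤ) ^ 2 - 1) ≠ 0 := by nlinarith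
  have hz : (Nat.card {u : GL (Fin 3) k // u ∈ unitaryGroupOfForm σ ((StdForm.antidiagonal 3).over k) ∧
      ((u : Matrix (Fin 3) (Fin 3) k) - 1) * ((u : Matrix (Fin 3) (Fin 3) k) - 1) = 0 ∧ u ≠ 1} : ℤ) = ((q : ℤ) ^ 3 + 1) * ((q : ℤ) - 1) :=
    mul_right_cancel₀ hne (by linear_combination hcz)
  have : (((q ^ 3 + 1) * (q - 1) : ℕ) : ℤ) = ((q : ℤ) ^ 3 + 1) * ((q : ℤ) - 1) := by push_cast [Nat.cast_sub hq1]; ring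
  exact_mod_cast hz.trans this.symm

/-- **`#{regular unipotents of U₃(𝔽_q)} = q(q² − 1)(q³ + 1)`** — the unipotents with `(u − 1)² ≠ 0` (ONE class by ★ Prop. 3.9.1, of size `|U₃(q)|∕q²(q+1)`): all unipotents `≠ 1` minus
the transvections, `(q³+1)(q³−1) − (q³+1)(q−1) = (q³+1)(q³−q)`. [cite: Rogawski1990, §3.9 p. 32, Prop. 3.9.1] [cite: Wilson2009, §3.6.2 p. 68] -/
theorem natCard_regularUnipotent (hk : Fintype.card k = q ^ 2) (σ : k →+* k) (hσ : ∀ x, σ x = x ^ q) :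
    Nat.card {u : GL (Fin 3) k // u ∈ unitaryGroupOfForm σ ((StdForm.antidiagonal 3).over k) ∧ IsNilpotent ((u : Matrix (Fin 3) (Fin 3) k) - 1) ∧
      ((u : Matrix (Fin 3) (Fin 3) k) - 1) * ((u : Matrix (Fin 3) (Fin 3) k) - 1) ≠ 0} = q * (q ^ 2 - 1) * (q ^ 3 + 1) := by
  classical
  have hall := natCard_unipotent_ne_one hk σ hσ
  have htr := natCard_transvection hk σ hσ
  -- split the unipotents `≠ 1` by `(u−1)² = 0`
  have hsplit := Nat.card_congr (Equiv.sumCompl fun x : {u : GL (Fin 3) k // u ∈ unitaryGroupOfForm σ ((StdForm.antidiagonal 3).over k) ∧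
      IsNilpotent ((u : Matrix (Fin 3) (Fin 3) k) - 1) ∧ u ≠ 1} =>
        (((x.1 : GL (Fin 3) k) : Matrix (Fin 3) (Fin 3) k) - 1) * (((x.1 : GL (Fin 3) k) : Matrix (Fin 3) (Fin 3) k) - 1) = 0).symm
  rw [Nat.card_sum, hall] at hsplit
  -- the `(u−1)² = 0` part ≃ transvections (nilpotency is automatic)
  have hA : Nat.card {x : {u : GL (Fin 3) k // u ∈ unitaryGroupOfForm σ ((StdForm.antidiagonal 3).over k) ∧
      IsNilpotent ((u : Matrix (Fin 3) (Fin 3) k) - 1) ∧ u ≠ 1} //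
        (((x.1 : GL (Fin 3) k) : Matrix (Fin 3) (Fin 3) k) - 1) * (((x.1 : GL (Fin 3) k) : Matrix (Fin 3) (Fin 3) k) - 1) = 0} = (q ^ 3 + 1) * (q - 1) := by
    rw [← htr]
    exact Nat.card_congr
      { toFun := fun x => ⟨x.1.1, x.1.2.1, x.2, x.1.2.2.2⟩
        invFun := fun u => ⟨⟨u.1, u.2.1, ⟨2, by rw [pow_two, u.2.2.1]⟩, u.2.2.2⟩, u.2.2.1⟩
        left_inv := fun x => rfl
        right_inv := fun u => rfl }
  -- the `(u−1)² ≠ 0` part ≃ the regular unipotents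
  have hB : Nat.card {x : {u : GL (Fin 3) k // u ∈ unitaryGroupOfForm σ ((StdForm.antidiagonal 3).over k) ∧
      IsNilpotent ((u : Matrix (Fin 3) (Fin 3) k) - 1) ∧ u ≠ 1} //
        ¬ (((x.1 : GL (Fin 3) k) : Matrix (Fin 3) (Fin 3) k) - 1) * (((x.1 : GL (Fin 3) k) : Matrix (Fin 3) (Fin 3) k) - 1) = 0} =
      Nat.card {u : GL (Fin 3) k // u ∈ unitaryGroupOfForm σ ((StdForm.antidiagonal 3).over k) ∧ IsNilpotent ((u : Matrix (Fin 3) (Fin 3) k) - 1) ∧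
        ((u : Matrix (Fin 3) (Fin 3) k) - 1) * ((u : Matrix (Fin 3) (Fin 3) k) - 1) ≠ 0} := by
    exact Nat.card_congr
      { toFun := fun x => ⟨x.1.1, x.1.2.1, x.1.2.2.1, x.2⟩
        invFun := fun u => ⟨⟨u.1, u.2.1, u.2.2.1, fun h1 => u.2.2.2 (by rw [h1, Units.val_one, sub_self, Matrix.zero_mul])⟩, u.2.2.2⟩
        left_inv := fun x => rfl
        right_inv := fun u => rfl }
  rw [hA, hB] at hsplit
  have h2 := two_le_q hk; have hq1 : 1 ≤ q := (by omega); have hq3 : 1 ≤ q ^ 3 := Nat.one_le_pow _ _ (by omega)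
  -- `(q³+1)(q³−1) − (q³+1)(q−1) = q(q²−1)(q³+1)`
  zify [hq1, hq3, Nat.one_le_pow 2 q (by omega)] at hsplit ⊢
  linear_combination -hsplit

end Literature.GroupTheory.SpecificGroups
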